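import Summits.MatrixMultiplication.MatrixMultiplication.Theorems.SoloBlindFamTables

/-!
# Solo-blind seat (MatrixMultiplication), s85 — the family checker, version two (paper/KraftK3.md K3.35, Q-K80)

A faster instance of the verified branch-and-bound of `SoloBlindFamChecker` for the per-family type oracle of
`SoloBlindFamTables`: the usable slots hitting each constraint are tabulated once per family (`hitTab`), member
sizes come from a table, and the cross-constraint lookahead is optional.  The search itself (`soloBlindBBTwo`) is
the same recursion as `soloBlindBB` with the available hitters read off the table; its soundness is proved the same
way, relative to the hypothesis that the table lists every usable hitter.  `soloBlindFamCheckTwo_sound` has the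
same conclusion as `soloBlindFamCheck_sound`, so the type model applies verbatim (`SoloBlindTypeModelTwo`).
Nothing here bears on `ω`.
-/

namespace Summit.MatrixMultiplication.MatrixMultiplication.Theorems

/-! ## The search with tabulated hitters -/

/-- A branch-and-bound instance together with a table of hitter lists, one per constraint. -/
structure SoloBlindBBInstTwo extends SoloBlindBBInst where
  /-- `hitTab[c]`: the usable slots hitting constraint `c` -/
  hitTab : Array (List ℕ)

/-- Total access to a table of lists. -/
def soloBlindLGet (A : Array (List ℕ)) (i : ℕ) : List ℕ := if h : i < A.size then A[i] else []

/-- Total access to a table of naturals. -/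
def soloBlindNGet (A : Array ℕ) (i : ℕ) : ℕ := if h : i < A.size then A[i] else 0

/-- The tabulated hitters of constraint `c`. -/
def SoloBlindBBInstTwo.hitters (I : SoloBlindBBInstTwo) (c : ℕ) : List ℕ := soloBlindLGet I.hitTab c

/-- Available hitters of constraint `c`: tabulated hitters neither chosen nor excluded. -/
def soloBlindAvailTwo (I : SoloBlindBBInstTwo) (c : ℕ) (U E : Finset ℕ) : List ℕ :=
  (I.hitters c).filter fun k => !decide (k ∈ U) && !decide (k ∈ E)

/-- The branching constraint: an unsatisfied constraint with fewest available hitters. -/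
def soloBlindPickTwo (I : SoloBlindBBInstTwo) (U E : Finset ℕ) (uns : List ℕ) : ℕ :=
  match uns.argmin (fun c => (soloBlindAvailTwo I c U E).length) with
  | some c => c
  | none => 0

/-- The fuelled branch-and-bound, version two (`look`: use the cross-constraint lookahead). -/
def soloBlindBBTwo (I : SoloBlindBBInstTwo) (S bound : ℕ) (look : Bool) :
    ℕ → Finset ℕ → Finset ℕ → Bool
  | 0, _, _ => false
  | fuel + 1, U, E =>
    if soloBlindVal I.toSoloBlindBBInst S U ≤ bound then true
    else if (soloBlindUnsat I.toSoloBlindBBInst U).isEmpty then false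
    else if look && (soloBlindUnsat I.toSoloBlindBBInst U).any (fun c =>
        (soloBlindAvailTwo I c U E).all fun k =>
          decide (soloBlindVal I.toSoloBlindBBInst S (insert k U) ≤ bound)) then true
    else soloBlindBranch (soloBlindBBTwo I S bound look fuel) U
        (soloBlindAvailTwo I (soloBlindPickTwo I U E (soloBlindUnsat I.toSoloBlindBBInst U)) U E) E

/-- The check from the empty selection. -/
def soloBlindCheckTwo (I : SoloBlindBBInstTwo) (S bound : ℕ) (look : Bool) : Bool :=
  soloBlindBBTwo I S bound look (I.nW + 1) ∅ ∅

/-! ## Soundness of the search -/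

/-- Membership in the list of available hitters. -/
theorem soloBlind_mem_availTwo {I : SoloBlindBBInstTwo} {c k : ℕ} {U E : Finset ℕ} :
    k ∈ soloBlindAvailTwo I c U E ↔ k ∈ I.hitters c ∧ k ∉ U ∧ k ∉ E := by
  unfold soloBlindAvailTwo
  rw [List.mem_filter]
  simp only [Bool.and_eq_true, Bool.not_eq_true', decide_eq_false_iff_not]

/-- The branching constraint is one of the unsatisfied constraints. -/
theorem soloBlindPickTwo_mem (I : SoloBlindBBInstTwo) (U E : Finset ℕ) {uns : List ℕ} (h : uns ≠ []) :
    soloBlindPickTwo I U E uns ∈ uns := by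
  unfold soloBlindPickTwo
  split
  · rename_i c hc
    exact List.argmin_mem hc
  · rename_i hnone
    exact absurd (List.argmin_eq_none.mp hnone) h

/-- A hitter of an unsatisfied constraint lying in a valid completion is available, provided the table
lists every usable hitter. -/
theorem soloBlind_hitter_availTwo {I : SoloBlindBBInstTwo} {U E V : Finset ℕ} {c : ℕ}
    (hT : ∀ c < I.ncons, ∀ k < I.nW, I.ok k = true → I.hit k c = true → k ∈ I.hitters c)
    (hc : c ∈ soloBlindUnsat I.toSoloBlindBBInst U) (hok : ∀ k ∈ V, k < I.nW ∧ I.ok k = true)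
    (hVE : ∀ k ∈ V, k ∉ U → k ∉ E) (hhit : ∀ c < I.ncons, ∃ k ∈ V, I.hit k c = true) :
    ∃ k ∈ soloBlindAvailTwo I c U E, k ∈ V := by
  obtain ⟨hcn, hno⟩ := soloBlind_mem_unsat hc
  obtain ⟨k, hkV, hk⟩ := hhit c hcn
  have hkU : k ∉ U := fun hkU => by simp [hno k hkU] at hk
  exact ⟨k, soloBlind_mem_availTwo.mpr
    ⟨hT c hcn k (hok k hkV).1 (hok k hkV).2 hk, hkU, hVE k hkV hkU⟩, hkV⟩

/-- SOUNDNESS OF THE SEARCH: if it answers `true` from `(U, E)` and the table lists every usable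
hitter, every valid completion `V` has objective `≤ bound`. -/
theorem soloBlindBBTwo_sound (I : SoloBlindBBInstTwo) (S bound : ℕ) (look : Bool)
    (hT : ∀ c < I.ncons, ∀ k < I.nW, I.ok k = true → I.hit k c = true → k ∈ I.hitters c) :
    ∀ (fuel : ℕ) (U E V : Finset ℕ), soloBlindBBTwo I S bound look fuel U E = true → U ⊆ V →
      (∀ k ∈ V, k < I.nW ∧ I.ok k = true) → (∀ k ∈ V, k ∉ U → k ∉ E) →
      (∀ c < I.ncons, ∃ k ∈ V, I.hit k c = true) → soloBlindVal I.toSoloBlindBBInst S V ≤ bound := by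
  intro fuel
  induction fuel with
  | zero => intro U E V hb; simp [soloBlindBBTwo] at hb
  | succ fuel ih =>
    intro U E V hb hUV hok hVE hhit
    unfold soloBlindBBTwo at hb
    split_ifs at hb with h1 h2 h3
    · exact (soloBlindVal_antitone _ S hUV).trans h1
    · obtain ⟨-, h3⟩ := (Bool.and_eq_true _ _).mp h3
      obtain ⟨c, hc, hall⟩ := List.any_eq_true.mp h3
      rw [List.all_eq_true] at hall
      obtain ⟨k, hk, hkV⟩ := soloBlind_hitter_availTwo hT hc hok hVE hhit
      have hle : soloBlindVal I.toSoloBlindBBInst S (insert k U) ≤ bound := by simpa using hall k hk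
      exact (soloBlindVal_antitone _ S (Finset.insert_subset hkV hUV)).trans hle
    · have hne : soloBlindUnsat I.toSoloBlindBBInst U ≠ [] := by
        intro he; rw [he] at h2; exact h2 rfl
      exact soloBlindBranch_sound hUV (fun U' E' hb' hU'V hVE' => ih U' E' V hb' hU'V hok hVE' hhit) _ E
        hb hVE (soloBlind_hitter_availTwo hT (soloBlindPickTwo_mem I U E hne) hok hVE hhit)

/-- SOUNDNESS OF THE CHECK, version two. -/
theorem soloBlindCheckTwo_sound (I : SoloBlindBBInstTwo) (S bound : ℕ) (look : Bool)
    (hT : ∀ c < I.ncons, ∀ k < I.nW, I.ok k = true → I.hit k c = true → k ∈ I.hitters c)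
    (h : soloBlindCheckTwo I S bound look = true)
    (V : Finset ℕ) (hok : ∀ k ∈ V, k < I.nW ∧ I.ok k = true)
    (hhit : ∀ c < I.ncons, ∃ k ∈ V, I.hit k c = true) : soloBlindVal I.toSoloBlindBBInst S V ≤ bound :=
  soloBlindBBTwo_sound I S bound look hT _ ∅ ∅ V h (Finset.empty_subset V) hok
    (fun _ _ _ => Finset.notMem_empty _) hhit

/-! ## The tabulated instance of a family -/

/-- The usable slots of the family `F`: those passing the `ok`-table at every member. -/
def soloBlindSlotsOf (T : SoloBlindTabs) (m : ℕ) (F : List ℕ) : List ℕ :=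
  (List.range (2 * 3 ^ (m + 1))).filter fun k => F.all fun M => soloBlindAGet T.okT (k * 2 ^ m + M)

/-- The hitter table of the family `F`: for each constraint, the usable slots hitting it. -/
def soloBlindHitTab (T : SoloBlindTabs) (m : ℕ) (F : List ℕ) (modeE : Bool) : Array (List ℕ) :=
  let W := soloBlindSlotsOf T m F
  Array.ofFn (n := soloBlindNCons m modeE) fun c =>
    W.filter fun k => soloBlindAGet T.hitT (k * (2 ^ (m + 1) - 1) + c)

/-- The table of member sizes `|M|` for `M < 2^m`. -/
def soloBlindCszTab (m : ℕ) : Array ℕ := Array.ofFn (n := 2 ^ m) fun M => (soloBlindDecSet m M).card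

/-- The tabulated instance of the family `F`. -/
def soloBlindInstTwo (T : SoloBlindTabs) (m : ℕ) (F : List ℕ) (modeE : Bool) : SoloBlindBBInstTwo :=
  let C := soloBlindCszTab m
  { soloBlindInstOf T m F modeE with
    hitTab := soloBlindHitTab T m F modeE
    csz := fun M => soloBlindNGet C M }

/-- The family check, version two, in mode `K` (bound `2^S`) or `E` (bound `2^{S-1}`). -/
def soloBlindFamCheckTwo (T : SoloBlindTabs) (m S : ℕ) (F : List ℕ) (modeE look : Bool) : Bool :=
  soloBlindCheckTwo (soloBlindInstTwo T m F modeE) S (if modeE then 2 ^ (S - 1) else 2 ^ S) look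

/-- The size table returns `|M|`. -/
theorem soloBlindNGet_cszTab {m M : ℕ} (hM : M < 2 ^ m) :
    soloBlindNGet (soloBlindCszTab m) M = (soloBlindDecSet m M).card := by
  unfold soloBlindNGet soloBlindCszTab
  rw [dif_pos (by simpa using hM), Array.getElem_ofFn]

/-- The hitter table lists every usable hitter. -/
theorem soloBlind_instTwo_hitters (T : SoloBlindTabs) (m : ℕ) (F : List ℕ) (modeE : Bool) {c k : ℕ}
    (hc : c < soloBlindNCons m modeE) (hk : k < 2 * 3 ^ (m + 1))
    (hok : (soloBlindInstOf T m F modeE).ok k = true) (hhit : (soloBlindInstOf T m F modeE).hit k c = true) :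
    k ∈ (soloBlindInstTwo T m F modeE).hitters c := by
  unfold SoloBlindBBInstTwo.hitters soloBlindLGet soloBlindInstTwo soloBlindHitTab
  simp only []
  rw [dif_pos (by simpa using hc), Array.getElem_ofFn, List.mem_filter]
  refine ⟨?_, hhit⟩
  unfold soloBlindSlotsOf
  rw [List.mem_filter, List.mem_range]
  exact ⟨hk, hok⟩

/-- SOUNDNESS OF THE FAMILY CHECK, version two — same conclusion as `soloBlindFamCheck_sound`. -/
theorem soloBlindFamCheckTwo_sound {m S : ℕ} {F : List ℕ} (hF : ∀ M ∈ F, M < 2 ^ m) {modeE look : Bool}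
    (h : soloBlindFamCheckTwo (soloBlindMkTabs m) m S F modeE look = true) (V : Finset ℕ)
    (hV : ∀ k ∈ V, k < 2 * 3 ^ (m + 1)) (hok : ∀ k ∈ V, ∀ M ∈ F, soloBlindOkSpec m k M = true)
    (hhit : ∀ c < soloBlindNCons m modeE, ∃ k ∈ V, soloBlindHitSpec m k c = true) :
    (F.map fun M => soloBlindPow2T S ((soloBlindDecSet m M).card +
      (V.filter fun k => soloBlindR1Spec m k M = true).card)).sum ≤
      (if modeE then 2 ^ (S - 1) else 2 ^ S) := by
  have hT : ∀ c < (soloBlindInstTwo (soloBlindMkTabs m) m F modeE).ncons,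
      ∀ k < (soloBlindInstTwo (soloBlindMkTabs m) m F modeE).nW,
      (soloBlindInstTwo (soloBlindMkTabs m) m F modeE).ok k = true →
      (soloBlindInstTwo (soloBlindMkTabs m) m F modeE).hit k c = true →
      k ∈ (soloBlindInstTwo (soloBlindMkTabs m) m F modeE).hitters c :=
    fun c hc k hk hok' hhit' => soloBlind_instTwo_hitters _ m F modeE hc hk hok' hhit'
  have hs := soloBlindCheckTwo_sound _ S _ look hT h V
    (fun k hk => ⟨hV k hk, (soloBlind_instOf_ok hF modeE (hV k hk)).mpr fun M hM => hok k hk M hM⟩)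
    (fun c hc => by
      obtain ⟨k, hkV, hkc⟩ := hhit c hc
      exact ⟨k, hkV, by
        rw [show (soloBlindInstTwo (soloBlindMkTabs m) m F modeE).hit k c =
            (soloBlindInstOf (soloBlindMkTabs m) m F modeE).hit k c from rfl,
          soloBlind_instOf_hit F modeE (hV k hkV) (lt_of_lt_of_le hc (soloBlind_ncons_le m modeE))]
        exact hkc⟩)
  have hval : soloBlindVal (soloBlindInstTwo (soloBlindMkTabs m) m F modeE).toSoloBlindBBInst S V =
      (F.map fun M => soloBlindPow2T S ((soloBlindDecSet m M).card +
        (V.filter fun k => soloBlindR1Spec m k M = true).card)).sum := by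
    unfold soloBlindVal soloBlindCnt
    show (F.map fun M => soloBlindPow2T S (soloBlindNGet (soloBlindCszTab m) M + _)).sum = _
    congr 1
    apply List.map_congr_left
    intro M hM
    rw [soloBlindNGet_cszTab (hF M hM)]
    congr 2
    apply congrArg Finset.card
    apply Finset.filter_congr
    intro k hk
    rw [show (soloBlindInstTwo (soloBlindMkTabs m) m F modeE).r1 k M =
        (soloBlindInstOf (soloBlindMkTabs m) m F modeE).r1 k M from rfl,
      soloBlind_instOf_r1 F modeE (hV k hk) (hF M hM)]
  rw [hval] at hs
  exact hs

end Summit.MatrixMultiplication.MatrixMultiplication.Theorems
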